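import Summits.QuantumFields.YangMills.Theorems.BalabanUVNodesK1WindowFirstStep
import Literature.MathematicalPhysics.QuantumFieldTheory.Balaban1983to89.Node00.Record13SepCoPH
import Literature.MathematicalPhysics.QuantumFieldTheory.Balaban1983to89.Node00.Record12NumericsWindow

/-!
# DAG node N13 ∕ crux K1⁷ — THE `K ≥ 1` WINDOW CLAUSE AT NODE 00's STAGE-13 DATUM `Node00.datumOfRecord₁₃SepCoPH F N θ h`: exact characterisation (ROW W12's twin at the
# v1.7 `SepCoPH` record) and the located roads to an inhabitant (first-step bound · `g²β ≤ c < 1` · rung 2's INTERVAL conjunct · the NAMED one-loop clause `Beta0LimitExists` at `k = 0`)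

Cell `pub-ymgap`, YM-PLAN Track A (HUMAN RULING D-0062 ∕ D-0149, director-ym №197), WIDTH SEAT `pub-ymgap-dag-n13-w4` (g0) on NODE n13 [Balaban1989LargeFieldII]; helper for crux K1⁷
`StabilityBAtRecordR13SepCoPH` = stmt-QuantumFields-20542 (plan g73 rev 24∕25; skeleton v5 `K1Skeleton13SepCoPHv5.lean` 38c62055d1ac34a4, rung 2 `BetaWindowAtSomeRecord13S`, skeleton-local
`Window D := ∃ γ₁ > 0, ∀ γ ∈ ]0, γ₁], ∃ P, 1 ≤ P.K ∧ (D.C P).flow.InInterval γ P.K`); W-SEAT-START-LIST v3 §1 n13 ITEM 4 = n24 ITEM 2 («the `Window` inhabitant at `datumOfRecord₁₃SepCoPH`»).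
FILE 2 of 2 (file 1 = `…K1WindowFirstStep`, the flow side).  COUNT-NEUTRAL.

WHAT THE WINDOW IS, AT THE RECORD.  `((datumOfRecord₁₃SepCoPH F N θ h).C P).flow.g = gOfRecord₁₃ F N θ.toStage13Params P = genSeq (betaOfRecord₁₃ …) P.g0` (`Node00.flow_g_datumOfRecord₁₃SepCoPH`,
`rfl`) and `betaOfRecord₁₃ = betaOfMerged β_m (beta0OfMerged β_m θ.v₀) θ.γ` with `β_m := betaMerged F (mergedTermFamilyMatT F N (TcanOfRecord F N) (chiβOfRecord₁₃ F N θ…) θ.εbg) θ.ρ8 θ.bV` (the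
merged second moment (1.22) of the limiting polarisation kernel of the record's `(TcanOfRecord, χ^{(2.9)})` family — a `tsum` of `limUnder`s).  By node00-def-K0a's ROW W12 flow lemmas
(`Node00/Record12NumericsWindow` §1, stated for every `HBeta`; §2 there reads them at the Stage-12 record over `(TcOfRecord, χ₇)`) the window at the Stage-13 record holds IFF «∃ γ₁ ∈ ]0, θ.γ],
∀ γ ∈ ]0, γ₁], ∃ g₀ ∈ ]0, γ], `β_m 0 (g₀) ≤ 1∕g₀² − 1∕γ²`» (`window_datumOfRecord₁₃SepCoPH_iff_merged`; the one-loop number is NOT read) — ONE real function of one variable near `0⁺`.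
Its upper bound ∕ limit as `g₀ → 0⁺` is the `k = 0` instance of [Balaban1987RG1] p. 264 «β_k(g) … uniformly bounded» ∕ (2.12)–(2.14) p. 268 (proof deferred in print; NODE O); no lemma of
the tree bounds it.  HENCE A HYPOTHESIS-FREE INHABITANT OF THE WINDOW AT THE RECORD = K0⁷ ∧ THAT FIRST-STEP ESTIMATE; it is NOT derivable from the record's provisos (which say
nothing about β) — LOCATED here, not typed around.  The endpoint-existence road is by name: `…N27SpineGivenEndpointR11Vacuity.window_of_endpointExistence (datumOfRecord₁₃SepCoPH F N θ h).C`.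

WHAT THIS FILE PROVES (general `N`; theorems only, 0 `def`, 0 `sorry`).
* §1 EXACT FORMS: `flow_inInterval_datumOfRecord₁₃SepCoPH_iff` (`Iff.rfl`) · `window_datumOfRecord₁₃SepCoPH_iff_firstBeta` (↔ the first-step condition on `betaOfRecord₁₃ … 0`) ·
  ★★ `window_datumOfRecord₁₃SepCoPH_iff_merged` (↔ the condition on the MERGED first β-function, `0 < θ.γ`) · `sq_mul_betaMerged_lt_one_of_window_datumOfRecord₁₃SepCoPH` (NECESSARY: along
  the witnesses `g₀²·β_m 0 (g₀) < 1` — a disprover's test).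
* §2 SUFFICIENT, LOCATED: `inInterval_one_datumOfRecord₁₃SepCoPH_of_level0Upper` (the EXPLICIT run `⟨1, m, (γ⁻² + max β⁺ 0)^{−1∕2}⟩`) · ★ `window_datumOfRecord₁₃SepCoPH_of_level0Upper` ·
  `…_of_firstBetaUpper` (raw β of record) · ★ `…_of_sq_mul_le` (a first β diverging like `c∕g²`, `c < 1`, is tolerated) · `…_of_betaBoundsInInterval` · ★ `…_of_world` (rung-2 currency:
  a world `w` with `w.C = D.C`, `0 < w.γ` — two conjuncts of `RecordS` — and the interval conjunct `BetaBoundsInInterval w.C.toB12 w.γ w.b w.βup` ⟹ the `Window` conjunct: THAT CONJUNCT OF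
  RUNG 2 IS REDUNDANT GIVEN THE INTERVAL CONJUNCT) · faces `betaOfRecord₁₃_zero_const_of_le ∕ _of_lt` · ★ `…_of_tendsto_betaMerged` and ★ `…_of_beta0LimitExists` (the NAMED clause
  `Node00.Beta0LimitExists β_m θ.v₀` of `Node00/BetaOfRecord` — already a displayed hypothesis of `…N17AtRecord13*` — read at `k = 0` ALONE gives the window: a β-CONTINUITY road).
* §3 the item's `N = 2` text verbatim: `window₂_datumOfRecord₁₃SepCoPH_of_world`, `window₂_datumOfRecord₁₃SepCoPH_of_beta0LimitExists`.

HONEST SCOPE (A6, №189).  Every theorem quantifies over `(θ, h : θ.Provisos₁₃SepCoPH F N)` — inhabited iff K0⁷ `Record13SepCoPHInhabited` (open crux stmt-QuantumFields-20541) — AND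
over ONE β-side input, each LOCATED and NOT discharged here: the first-step bound ([I] p. 264 at `k = 0`), the interval conjunct (the same + the UNPRINTED lower letter, T09.F), the one-loop
limit at the first step ((2.12)–(2.14) p. 268).  `rfl` faces + file 1's and ROW W12's elementary flow lemmas; nothing of Bałaban's analysis is asserted or used; N13 NOT discharged; K1⁷
NOT closed; no stub closed; counts unmoved (typed 28∕28 · discharged 5∕27 · A 5∕28).  One finite four-torus programme at fixed `ε = L^{−K}`, Bałaban AS PRINTED; the YM mass gap (Clay) is
NOT proved by any of this — R4 closes the conditional finite-𝕋⁴ rung `BalabanLadder.UV` only; nothing continuum ∕ ℝ⁴ ∕ OS.  No `instance`, no `notation`, no `axiom`.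
References: [I] = [Balaban1987RG1] CMP **109** (1987): (0.17)–(0.20) pp. 255–256, Thm 2 p. 259, (1.20)–(1.22) p. 264, (2.9) p. 266, (2.12)–(2.14) p. 268; [B16] = [Balaban1989LargeFieldII]
CMP **122** (1989): Thm 1 + (0.1) pp. 355–356.
-/

noncomputable section

open scoped Matrix.Norms.L2Operator

namespace Summit.QuantumFields.YangMills.Theorems.BalabanUVNodesN13WindowAtRecord13SepCoPH

open Literature.MathematicalPhysics.QuantumFieldTheory.Balaban1983to89
open Literature.MathematicalPhysics.QuantumFieldTheory.Balaban1983to89.FlowStep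
open Literature.MathematicalPhysics.QuantumFieldTheory.Balaban1983to89.FlowStepRuns
open Literature.MathematicalPhysics.QuantumFieldTheory.Balaban1983to89.DagBinding
open Literature.MathematicalPhysics.QuantumFieldTheory.Balaban1983to89.T4Continuum (T4Family FiniteEpsData)
open Literature.MathematicalPhysics.QuantumFieldTheory.Balaban1983to89.Node00
open Summit.QuantumFields.YangMills.Theorems.BalabanUVNodesK1WindowFirstStep
open Filter Topology

variable {F : T4Family} {N : ℕ} [NeZero N]

/-! ## §1. Exact forms at the Stage-13 datum: the window reads the FIRST β-function of record (on the box: the MERGED one) and nothing else -/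

section Exact

/-- **At the datum of record, for EVERY proviso witness `h`: the window clause of the run `P` IS the raw-sequence clause on `gOfRecord₁₃ θ.toStage13Params P`** (def-T's face
`flow_g_datumOfRecord₁₃SepCoPH`; `Iff.rfl`) — the window reads neither `h`, nor `Zh ∕ Phih`, nor any residual object. [cite: Balaban1987RG1, (0.17)–(0.20) pp.255–256; Balaban1989LargeFieldII, Thm 1 p.355 (bookkeeping)] -/
theorem flow_inInterval_datumOfRecord₁₃SepCoPH_iff (θ : Stage13HParams F N) (h : θ.Provisos₁₃SepCoPH F N) (γ : ℝ) (P : B12.RunParams) (K : ℕ) :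
    ((datumOfRecord₁₃SepCoPH F N θ h).C P).flow.InInterval γ K ↔ Step.InInterval γ K (gOfRecord₁₃ F N θ.toStage13Params P) :=
  Iff.rfl

/-- **THE WINDOW AT THE STAGE-13 DATUM ↔ THE FIRST-STEP CONDITION ON THE FIRST β-FUNCTION OF RECORD**: «∃ γ₁ > 0, ∀ γ ∈ ]0, γ₁], ∃ g₀ ∈ ]0, γ],
`betaOfRecord₁₃ F N θ.toStage13Params 0 (g₀) ≤ 1∕g₀² − 1∕γ²`» (ROW W12's `Node00.window_genSeq_iff` at `β := betaOfRecord₁₃ …`; no hypothesis on `θ`).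
[cite: Balaban1987RG1, (0.17)–(0.20) pp.255–256 and (1.20)–(1.22) p.264; Balaban1989LargeFieldII, Thm 1 + (0.1) pp.355–356 (bookkeeping + elementary)] -/
theorem window_datumOfRecord₁₃SepCoPH_iff_firstBeta (θ : Stage13HParams F N) (h : θ.Provisos₁₃SepCoPH F N) :
    (∃ γ₁ : ℝ, 0 < γ₁ ∧ ∀ γ : ℝ, 0 < γ → γ ≤ γ₁ →
        ∃ P : B12.RunParams, 1 ≤ P.K ∧ ((datumOfRecord₁₃SepCoPH F N θ h).C P).flow.InInterval γ P.K) ↔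
      ∃ γ₁ : ℝ, 0 < γ₁ ∧ ∀ γ : ℝ, 0 < γ → γ ≤ γ₁ →
        ∃ g0 : ℝ, (0 < g0 ∧ g0 ≤ γ) ∧ betaOfRecord₁₃ F N θ.toStage13Params 0 (fun _ => g0) ≤ 1 / g0 ^ 2 - 1 / γ ^ 2 :=
  window_genSeq_iff (betaOfRecord₁₃ F N θ.toStage13Params)

/-- ★★ **THE WINDOW AT THE STAGE-13 DATUM ↔ THE LEVEL-0 MERGED-β CONDITION** (`0 < θ.γ`; every `h`): `(∃ γ₁ > 0, ∀ γ ∈ ]0, γ₁], ∃ P, 1 ≤ P.K ∧ run in ]0, γ]) ↔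
(∃ γ₁ ∈ ]0, θ.γ], ∀ γ ∈ ]0, γ₁], ∃ g₀ ∈ ]0, γ], β_m 0 (g₀) ≤ 1∕g₀² − 1∕γ²)` with `β_m` the MERGED β of the record's `(TcanOfRecord, χ^{(2.9)})` term family — ONE real inequality per
`(γ, g₀)` on the (1.22) second moment of the limiting level-1 kernel; the one-loop number `beta0OfMerged … θ.v₀`, the residual objects, the provisos and every other numeral of `θ` are NOT
read (ROW W12's `Node00.window_betaOfMerged_iff`; `betaOfRecord₁₃ = betaOfRecord₈Tχ … = betaOfMerged β_m β⁰ θ.γ`). = THE KERNEL CENSUS OF THE ITEM.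
[cite: Balaban1987RG1, (0.17)–(0.20) pp.255–256, (1.20)–(1.22) p.264, (2.9) p.266, (2.12)–(2.14) p.268; Balaban1989LargeFieldII, Thm 1 + (0.1) pp.355–356 (bookkeeping + elementary)] -/
theorem window_datumOfRecord₁₃SepCoPH_iff_merged (θ : Stage13HParams F N) (h : θ.Provisos₁₃SepCoPH F N) (hγθ : 0 < θ.γ) :
    (∃ γ₁ : ℝ, 0 < γ₁ ∧ ∀ γ : ℝ, 0 < γ → γ ≤ γ₁ →
        ∃ P : B12.RunParams, 1 ≤ P.K ∧ ((datumOfRecord₁₃SepCoPH F N θ h).C P).flow.InInterval γ P.K) ↔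
      ∃ γ₁ : ℝ, 0 < γ₁ ∧ γ₁ ≤ θ.γ ∧ ∀ γ : ℝ, 0 < γ → γ ≤ γ₁ →
        ∃ g0 : ℝ, (0 < g0 ∧ g0 ≤ γ) ∧
          (letI := θ.instVβ₁; letI := θ.instVβ₂; letI := θ.instιβ
           betaMerged F (mergedTermFamilyMatT F N (TcanOfRecord F N) (chiβOfRecord₁₃ F N θ.toStage13Params) θ.εbg) θ.ρ8 θ.bV 0 (fun _ => g0) ≤
             1 / g0 ^ 2 - 1 / γ ^ 2) := by
  show (∃ γ₁ : ℝ, 0 < γ₁ ∧ ∀ γ : ℝ, 0 < γ → γ ≤ γ₁ → ∃ P : B12.RunParams, 1 ≤ P.K ∧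
      Step.InInterval γ P.K (genSeq (betaOfRecord₈Tχ F N (TβOfRecord₁₃ F N) (chiβOfRecord₁₃ F N θ.toStage13Params) θ.toStage8Params) P.g0)) ↔ _
  unfold betaOfRecord₈Tχ
  exact window_betaOfMerged_iff _ _ hγθ

/-- **NECESSARY: along the window's witnesses the merged first β-function stays below `g⁻²`** — if the window holds at the Stage-13 datum (`0 < θ.γ`) then for all small `γ` some
`g₀ ∈ ]0, γ]` has `g₀² · β_m 0 (g₀) < 1`.  A test for the disprover: a merged level-0 β dominating `g⁻²` near `0⁺` refutes the window conjunct at that `θ` (ROW W12's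
`Node00.sq_mul_betaMerged_lt_one_of_window`; compare file 1's sufficient `firstStep_of_sq_mul_le`: `g²β ≤ c < 1` eventually). [cite: Balaban1987RG1, (0.17)–(0.20) pp.255–256 and (1.22) p.264 (elementary)] -/
theorem sq_mul_betaMerged_lt_one_of_window_datumOfRecord₁₃SepCoPH (θ : Stage13HParams F N) (h : θ.Provisos₁₃SepCoPH F N) (hγθ : 0 < θ.γ)
    (hw : ∃ γ₁ : ℝ, 0 < γ₁ ∧ ∀ γ : ℝ, 0 < γ → γ ≤ γ₁ →
      ∃ P : B12.RunParams, 1 ≤ P.K ∧ ((datumOfRecord₁₃SepCoPH F N θ h).C P).flow.InInterval γ P.K) :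
    ∃ γ₁ : ℝ, 0 < γ₁ ∧ γ₁ ≤ θ.γ ∧ ∀ γ : ℝ, 0 < γ → γ ≤ γ₁ →
      ∃ g0 : ℝ, (0 < g0 ∧ g0 ≤ γ) ∧
        g0 ^ 2 * (letI := θ.instVβ₁; letI := θ.instVβ₂; letI := θ.instιβ
          betaMerged F (mergedTermFamilyMatT F N (TcanOfRecord F N) (chiβOfRecord₁₃ F N θ.toStage13Params) θ.εbg) θ.ρ8 θ.bV 0 (fun _ => g0)) < 1 := by
  have hw' : ∃ γ₁ : ℝ, 0 < γ₁ ∧ ∀ γ : ℝ, 0 < γ → γ ≤ γ₁ → ∃ P : B12.RunParams, 1 ≤ P.K ∧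
      Step.InInterval γ P.K (genSeq (betaOfRecord₈Tχ F N (TβOfRecord₁₃ F N) (chiβOfRecord₁₃ F N θ.toStage13Params) θ.toStage8Params) P.g0) := hw
  unfold betaOfRecord₈Tχ at hw'
  exact sq_mul_betaMerged_lt_one_of_window _ _ hγθ hw'

end Exact

/-! ## §2. Sufficient, LOCATED inputs at the Stage-13 datum (each a displayed hypothesis; none discharged here) -/

section Sufficient

/-- **THE EXPLICIT RUN.**  Under a LEVEL-0 upper bound `β_m 0 (g) ≤ β⁺` on `]0, γ₁]`, `γ₁ ≤ θ.γ`, of the merged first β-function of record: for every `γ ∈ ]0, γ₁]` and every torus exponent `m`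
the run `⟨1, m, (γ⁻² + max β⁺ 0)^{−1∕2}⟩` of the Stage-13 datum is in the `]0, γ]`-window (ROW W12's `Node00.inInterval_one_betaOfMerged_of_level0Upper`).
[cite: Balaban1987RG1, (0.17)–(0.20) pp.255–256 and §1 p.264 («uniformly bounded», level 0; elementary consequence)] -/
theorem inInterval_one_datumOfRecord₁₃SepCoPH_of_level0Upper (θ : Stage13HParams F N) (h : θ.Provisos₁₃SepCoPH F N) {γ₁ βup : ℝ} (hγ₁θ : γ₁ ≤ θ.γ)
    (hup : ∀ g : ℝ, 0 < g → g ≤ γ₁ →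
      (letI := θ.instVβ₁; letI := θ.instVβ₂; letI := θ.instιβ
       betaMerged F (mergedTermFamilyMatT F N (TcanOfRecord F N) (chiβOfRecord₁₃ F N θ.toStage13Params) θ.εbg) θ.ρ8 θ.bV 0 (fun _ => g) ≤ βup))
    (m : ℕ) {γ : ℝ} (hγ : 0 < γ) (hγle : γ ≤ γ₁) :
    ((datumOfRecord₁₃SepCoPH F N θ h).C ⟨1, m, solveCoupling (1 / γ ^ 2 + max βup 0)⟩).flow.InInterval γ 1 := by
  show Step.InInterval γ 1 (genSeq (betaOfRecord₈Tχ F N (TβOfRecord₁₃ F N) (chiβOfRecord₁₃ F N θ.toStage13Params) θ.toStage8Params)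
    (solveCoupling (1 / γ ^ 2 + max βup 0)))
  unfold betaOfRecord₈Tχ
  exact inInterval_one_betaOfMerged_of_level0Upper _ _ hγ₁θ hup hγ hγle

/-- ★ **SUFFICIENT: a LEVEL-0 upper bound of the MERGED first β-function of record on `]0, γ₁]`, `0 < γ₁ ≤ θ.γ`, gives the window at the Stage-13 datum** (runs
`⟨1, m, (γ⁻² + max β⁺ 0)^{−1∕2}⟩`).  The hypothesis is the `k = 0` instance of [I] p. 264 «β … uniformly bounded on this interval» (proof deferred in print; NODE O) — DISPLAYED, not
discharged; strictly less than the all-step `FlowStep.BetaUpperH` of dag-n24-a's `Node00.N24_window_allK_of_betaUpperH`. [cite: Balaban1987RG1, (0.17)–(0.20) pp.255–256 and §1 p.264; Balaban1989LargeFieldII, Thm 1 + (0.1) pp.355–356 (bookkeeping)] -/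
theorem window_datumOfRecord₁₃SepCoPH_of_level0Upper (θ : Stage13HParams F N) (h : θ.Provisos₁₃SepCoPH F N) {γ₁ βup : ℝ} (hγ₁ : 0 < γ₁) (hγ₁θ : γ₁ ≤ θ.γ)
    (hup : ∀ g : ℝ, 0 < g → g ≤ γ₁ →
      (letI := θ.instVβ₁; letI := θ.instVβ₂; letI := θ.instιβ
       betaMerged F (mergedTermFamilyMatT F N (TcanOfRecord F N) (chiβOfRecord₁₃ F N θ.toStage13Params) θ.εbg) θ.ρ8 θ.bV 0 (fun _ => g) ≤ βup)) (m : ℕ) :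
    ∃ γ₁ : ℝ, 0 < γ₁ ∧ ∀ γ : ℝ, 0 < γ → γ ≤ γ₁ →
      ∃ P : B12.RunParams, 1 ≤ P.K ∧ ((datumOfRecord₁₃SepCoPH F N θ h).C P).flow.InInterval γ P.K :=
  ⟨γ₁, hγ₁, fun γ hγ hγle => ⟨⟨1, m, solveCoupling (1 / γ ^ 2 + max βup 0)⟩, le_rfl,
    inInterval_one_datumOfRecord₁₃SepCoPH_of_level0Upper θ h hγ₁θ hup m hγ hγle⟩⟩

/-- **SUFFICIENT, in the raw β of record**: `betaOfRecord₁₃ F N θ.toStage13Params 0 (g) ≤ β⁺` for `g ∈ ]0, γ₁]`, `γ₁ > 0` ⟹ the window (file 1's `window_of_level0Upper`;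
`βfun_datumOfRecord₁₃SepCoPH`, `rfl`; no hypothesis on `θ.γ`). [cite: Balaban1987RG1, (0.17)–(0.20) pp.255–256 and §1 p.264; Balaban1989LargeFieldII, Thm 1 + (0.1) pp.355–356 (bookkeeping)] -/
theorem window_datumOfRecord₁₃SepCoPH_of_firstBetaUpper (θ : Stage13HParams F N) (h : θ.Provisos₁₃SepCoPH F N) {γ₁ βup : ℝ} (hγ₁ : 0 < γ₁)
    (hup : ∀ g : ℝ, 0 < g → g ≤ γ₁ → betaOfRecord₁₃ F N θ.toStage13Params 0 (fun _ => g) ≤ βup) :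
    ∃ γ₁ : ℝ, 0 < γ₁ ∧ ∀ γ : ℝ, 0 < γ → γ ≤ γ₁ →
      ∃ P : B12.RunParams, 1 ≤ P.K ∧ ((datumOfRecord₁₃SepCoPH F N θ h).C P).flow.InInterval γ P.K :=
  window_of_level0Upper (datumOfRecord₁₃SepCoPH F N θ h) hγ₁ hup

/-- ★ **SUFFICIENT: a first β-function of record diverging like `c∕g²`, `c < 1`, is tolerated** — `g² · betaOfRecord₁₃ … 0 (g) ≤ c` eventually at `0⁺` ⟹ the window
(file 1's `firstStep_of_sq_mul_le` + `window_datumOfRecord₁₃SepCoPH_iff_firstBeta`). [cite: Balaban1987RG1, (0.17)–(0.20) pp.255–256 and §1 p.264; Balaban1989LargeFieldII, Thm 1 + (0.1) pp.355–356 (bookkeeping)] -/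
theorem window_datumOfRecord₁₃SepCoPH_of_sq_mul_le (θ : Stage13HParams F N) (h : θ.Provisos₁₃SepCoPH F N) {c : ℝ} (hc : c < 1)
    (hle : ∀ᶠ x in 𝓝[>] (0 : ℝ), x ^ 2 * betaOfRecord₁₃ F N θ.toStage13Params 0 (fun _ => x) ≤ c) :
    ∃ γ₁ : ℝ, 0 < γ₁ ∧ ∀ γ : ℝ, 0 < γ → γ ≤ γ₁ →
      ∃ P : B12.RunParams, 1 ≤ P.K ∧ ((datumOfRecord₁₃SepCoPH F N θ h).C P).flow.InInterval γ P.K :=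
  (window_datumOfRecord₁₃SepCoPH_iff_firstBeta θ h).mpr (firstStep_of_sq_mul_le _ hc hle)

/-- **SUFFICIENT: the INTERVAL binder** `BetaBoundsInInterval (datumOfRecord₁₃SepCoPH F N θ h).C.toB12 γ₀ b b′`, `γ₀ > 0` (only `b′` at `j = 0` is read).
[cite: Balaban1987RG1, §1 (1.22) p.264 and (0.17)–(0.20) pp.255–256; Balaban1989LargeFieldII, Thm 1 + (0.1) pp.355–356 (bookkeeping)] -/
theorem window_datumOfRecord₁₃SepCoPH_of_betaBoundsInInterval (θ : Stage13HParams F N) (h : θ.Provisos₁₃SepCoPH F N) {γ₀ b b' : ℝ} (hγ₀ : 0 < γ₀)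
    (hβ : BetaBoundsInInterval (datumOfRecord₁₃SepCoPH F N θ h).C.toB12 γ₀ b b') :
    ∃ γ₁ : ℝ, 0 < γ₁ ∧ ∀ γ : ℝ, 0 < γ → γ ≤ γ₁ →
      ∃ P : B12.RunParams, 1 ≤ P.K ∧ ((datumOfRecord₁₃SepCoPH F N θ h).C P).flow.InInterval γ P.K :=
  window_of_betaBoundsInInterval (datumOfRecord₁₃SepCoPH F N θ h) hγ₀ hβ

/-- ★ **RUNG 2's `Window` CONJUNCT IS REDUNDANT GIVEN ITS INTERVAL CONJUNCT.**  In K1⁷ v5's `BetaWindowAtSomeRecord13S` the world `w` satisfies `RecordS F θ h w`, whose conjuncts include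
`w.C = (datumOfRecord₁₃SepCoPH F 2 θ h).C` and `0 < w.γ`; together with the interval conjunct `BetaBoundsInInterval w.C.toB12 w.γ w.b w.βup` these ALREADY give
`Window (datumOfRecord₁₃SepCoPH F 2 θ h)` (general `N` here) — so `stub_betaWindow13PWS` asks for the nodes (given) and the interval binder ONLY.
[cite: Balaban1987RG1, §1 (1.22) p.264 and (0.17)–(0.20) pp.255–256; Balaban1989LargeFieldII, Thm 1 + (0.1) pp.355–356 (bookkeeping)] -/
theorem window_datumOfRecord₁₃SepCoPH_of_world (θ : Stage13HParams F N) (h : θ.Provisos₁₃SepCoPH F N) (w : WorldP)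
    (hC : w.C = (datumOfRecord₁₃SepCoPH F N θ h).C) (hγ : 0 < w.γ) (hβ : BetaBoundsInInterval w.C.toB12 w.γ w.b w.βup) :
    ∃ γ₁ : ℝ, 0 < γ₁ ∧ ∀ γ : ℝ, 0 < γ → γ ≤ γ₁ →
      ∃ P : B12.RunParams, 1 ≤ P.K ∧ ((datumOfRecord₁₃SepCoPH F N θ h).C P).flow.InInterval γ P.K := by
  rw [hC] at hβ
  exact window_of_betaBoundsInInterval (datumOfRecord₁₃SepCoPH F N θ h) hγ hβ

/-- FACE: ON the box `]0, θ.γ]` the first β-function of record at the constant history `(x)` IS the merged second moment (1.22) of the record's `(TcanOfRecord, χ^{(2.9)})` term family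
(`Node00.betaOfMerged_of_mem`). [cite: Balaban1987RG1, (1.20)–(1.22) p.264 and (2.9) p.266] -/
theorem betaOfRecord₁₃_zero_const_of_le (θ : Stage13HParams F N) {x : ℝ} (hx : 0 < x) (hxγ : x ≤ θ.γ) :
    letI := θ.instVβ₁; letI := θ.instVβ₂; letI := θ.instιβ
    betaOfRecord₁₃ F N θ.toStage13Params 0 (fun _ => x) =
      betaMerged F (mergedTermFamilyMatT F N (TcanOfRecord F N) (chiβOfRecord₁₃ F N θ.toStage13Params) θ.εbg) θ.ρ8 θ.bV 0 (fun _ => x) := by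
  letI := θ.instVβ₁; letI := θ.instVβ₂; letI := θ.instιβ
  exact betaOfMerged_of_mem _ _ _ (const_mem_box_zero_iff.mpr ⟨hx, hxγ⟩)

/-- FACE: OFF the box (`θ.γ < x`) the first β-function of record at `(x)` IS the one-loop number `beta0OfMerged … θ.v₀ 0` (`Node00.betaOfMerged_of_notMem`).
[cite: Balaban1987RG1, (2.12)–(2.14) p.268] -/
theorem betaOfRecord₁₃_zero_const_of_lt (θ : Stage13HParams F N) {x : ℝ} (hγx : θ.γ < x) :
    letI := θ.instVβ₁; letI := θ.instVβ₂; letI := θ.instιβ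
    betaOfRecord₁₃ F N θ.toStage13Params 0 (fun _ => x) =
      beta0OfMerged (betaMerged F (mergedTermFamilyMatT F N (TcanOfRecord F N) (chiβOfRecord₁₃ F N θ.toStage13Params) θ.εbg) θ.ρ8 θ.bV) θ.v₀ 0 := by
  letI := θ.instVβ₁; letI := θ.instVβ₂; letI := θ.instιβ
  exact betaOfMerged_of_notMem _ _ _ fun hmem => (not_le.mpr hγx) (const_mem_box_zero_iff.mp hmem).2

/-- ★ **SUFFICIENT: THE ONE-SIDED LIMIT OF THE MERGED FIRST β-FUNCTION AT `0⁺` EXISTS** — `β_m 0 (x) → L` as `x → 0⁺` ⟹ the first β-function OF RECORD is eventually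
`≤ max (L + 1) β⁰_1` at `0⁺` (on the box it is `β_m`, off it `β⁰_1`; no hypothesis on `θ.γ`), whence the window (file 1's `window_of_eventually_le`).  A CONTINUITY input at the first step,
not a uniform bound; DISPLAYED, not discharged. [cite: Balaban1987RG1, (1.20)–(1.22) p.264 and (2.12)–(2.14) p.268; Balaban1989LargeFieldII, Thm 1 + (0.1) pp.355–356 (bookkeeping)] -/
theorem window_datumOfRecord₁₃SepCoPH_of_tendsto_betaMerged (θ : Stage13HParams F N) (h : θ.Provisos₁₃SepCoPH F N) {L : ℝ}
    (hlim : letI := θ.instVβ₁; letI := θ.instVβ₂; letI := θ.instιβ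
      Tendsto (fun x : ℝ =>
        betaMerged F (mergedTermFamilyMatT F N (TcanOfRecord F N) (chiβOfRecord₁₃ F N θ.toStage13Params) θ.εbg) θ.ρ8 θ.bV 0 (fun _ => x))
        (𝓝[>] (0 : ℝ)) (𝓝 L)) :
    ∃ γ₁ : ℝ, 0 < γ₁ ∧ ∀ γ : ℝ, 0 < γ → γ ≤ γ₁ →
      ∃ P : B12.RunParams, 1 ≤ P.K ∧ ((datumOfRecord₁₃SepCoPH F N θ h).C P).flow.InInterval γ P.K := by
  letI := θ.instVβ₁; letI := θ.instVβ₂; letI := θ.instιβ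
  set βm := betaMerged F (mergedTermFamilyMatT F N (TcanOfRecord F N) (chiβOfRecord₁₃ F N θ.toStage13Params) θ.εbg) θ.ρ8 θ.bV with hβm
  refine window_of_eventually_le (datumOfRecord₁₃SepCoPH F N θ h) (b := max (L + 1) (beta0OfMerged βm θ.v₀ 0)) ?_
  have hev : ∀ᶠ x in 𝓝[>] (0 : ℝ), βm 0 (fun _ => x) ≤ L + 1 := hlim.eventually (eventually_le_nhds (lt_add_one L))
  have hpos : ∀ᶠ x in 𝓝[>] (0 : ℝ), 0 < x := eventually_mem_nhdsWithin
  filter_upwards [hev, hpos] with x hx hx0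
  show betaOfRecord₁₃ F N θ.toStage13Params 0 (fun _ => x) ≤ _
  rcases le_or_gt x θ.γ with hxγ | hγx
  · rw [betaOfRecord₁₃_zero_const_of_le θ hx0 hxγ]
    exact hx.trans (le_max_left _ _)
  · rw [betaOfRecord₁₃_zero_const_of_lt θ hγx]
    exact le_max_right _ _

/-- ★ **SUFFICIENT: THE NAMED ONE-LOOP-LIMIT CLAUSE** `Node00.Beta0LimitExists β_m θ.v₀` (chair R434 (c3): «the existence of the limit a NAMED Prop»; already a displayed hypothesis of
`…N17AtRecord13*`) — only its `k = 0` instance is read (a length-one reference history updated at its last slot is the constant history).  DISPLAYED, not discharged.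
[cite: Balaban1987RG1, (2.12)–(2.14) p.268 and (1.22) p.264; Balaban1989LargeFieldII, Thm 1 + (0.1) pp.355–356 (bookkeeping)] -/
theorem window_datumOfRecord₁₃SepCoPH_of_beta0LimitExists (θ : Stage13HParams F N) (h : θ.Provisos₁₃SepCoPH F N)
    (hlim : letI := θ.instVβ₁; letI := θ.instVβ₂; letI := θ.instιβ
      Beta0LimitExists (betaMerged F (mergedTermFamilyMatT F N (TcanOfRecord F N) (chiβOfRecord₁₃ F N θ.toStage13Params) θ.εbg) θ.ρ8 θ.bV) θ.v₀) :
    ∃ γ₁ : ℝ, 0 < γ₁ ∧ ∀ γ : ℝ, 0 < γ → γ ≤ γ₁ →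
      ∃ P : B12.RunParams, 1 ≤ P.K ∧ ((datumOfRecord₁₃SepCoPH F N θ h).C P).flow.InInterval γ P.K := by
  letI := θ.instVβ₁; letI := θ.instVβ₂; letI := θ.instιβ
  obtain ⟨b, hb⟩ := hlim 0
  have hupd : ∀ g : ℝ, Function.update (θ.v₀ 0) (Fin.last 0) g = fun _ => g := fun g => by
    funext i
    rw [Subsingleton.elim (α := Fin 1) i (Fin.last 0)]
    simp
  simp only [hupd] at hb
  exact window_datumOfRecord₁₃SepCoPH_of_tendsto_betaMerged θ h hb

end Sufficient

/-! ## §3. The item's `N = 2` text (the last conjunct of K1⁷ `StabilityBAtRecordR13SepCoPH` ∕ the window hypothesis of K2⁷ `EndpointGivenBR13SepCoPH`, verbatim) -/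

section ItemText

variable {F : T4Family}

/-- ★ `N = 2`: the `Window` conjunct of K1⁷ v5's rung 2 at `(θ, h)` from a world `w` with `w.C = D.C`, `0 < w.γ` and the interval conjunct. [cite: Balaban1987RG1, §1 (1.22) p.264 and (0.17)–(0.20) pp.255–256; Balaban1989LargeFieldII, Thm 1 + (0.1) pp.355–356 (bookkeeping)] -/
theorem window₂_datumOfRecord₁₃SepCoPH_of_world (θ : Stage13HParams F 2) (h : θ.Provisos₁₃SepCoPH F 2) (w : WorldP)
    (hC : w.C = (datumOfRecord₁₃SepCoPH F 2 θ h).C) (hγ : 0 < w.γ) (hβ : BetaBoundsInInterval w.C.toB12 w.γ w.b w.βup) :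
    ∃ γ₁ : ℝ, 0 < γ₁ ∧ ∀ γ : ℝ, 0 < γ → γ ≤ γ₁ →
      ∃ P : Literature.MathematicalPhysics.QuantumFieldTheory.Balaban1983to89.B12.RunParams, 1 ≤ P.K ∧
        ((Literature.MathematicalPhysics.QuantumFieldTheory.Balaban1983to89.Node00.datumOfRecord₁₃SepCoPH F 2 θ h).C P).flow.InInterval γ P.K :=
  window_datumOfRecord₁₃SepCoPH_of_world θ h w hC hγ hβ

/-- ★ `N = 2`: the window at `datumOfRecord₁₃SepCoPH F 2 θ h` from the NAMED one-loop-limit clause at `k = 0`. [cite: Balaban1987RG1, (2.12)–(2.14) p.268 and (1.22) p.264; Balaban1989LargeFieldII, Thm 1 + (0.1) pp.355–356 (bookkeeping)] -/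
theorem window₂_datumOfRecord₁₃SepCoPH_of_beta0LimitExists (θ : Stage13HParams F 2) (h : θ.Provisos₁₃SepCoPH F 2)
    (hlim : letI := θ.instVβ₁; letI := θ.instVβ₂; letI := θ.instιβ
      Beta0LimitExists (betaMerged F (mergedTermFamilyMatT F 2 (TcanOfRecord F 2) (chiβOfRecord₁₃ F 2 θ.toStage13Params) θ.εbg) θ.ρ8 θ.bV) θ.v₀) :
    ∃ γ₁ : ℝ, 0 < γ₁ ∧ ∀ γ : ℝ, 0 < γ → γ ≤ γ₁ →
      ∃ P : Literature.MathematicalPhysics.QuantumFieldTheory.Balaban1983to89.B12.RunParams, 1 ≤ P.K ∧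
        ((Literature.MathematicalPhysics.QuantumFieldTheory.Balaban1983to89.Node00.datumOfRecord₁₃SepCoPH F 2 θ h).C P).flow.InInterval γ P.K :=
  window_datumOfRecord₁₃SepCoPH_of_beta0LimitExists θ h hlim

end ItemText

/-! ### v1.1 (append-only; pub-ymgap-dag-n13-w4 g0 INTENT-2): FREQUENTLY SUFFICES at the Stage-13 datum — along SOME sequence of bare couplings `gₙ → 0⁺` with
`gₙ²·β ≤ c < 1` the window holds (file 1 v1.1 `firstStep_of_frequently_sq_mul_le`); with §1's necessary form: the window at the record holds IF `liminf_{g→0⁺} g²·β_m 0 (g) < 1`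
and ONLY IF `g²·β_m 0 (g) < 1` frequently at `0⁺`.  Same HONEST SCOPE as above (count-neutral; nothing of Bałaban's asserted; the YM mass gap (Clay) is NOT proved — R4 closes the
conditional finite-𝕋⁴ rung `BalabanLadder.UV` only). -/

/-! ## §4 (v1.1). FREQUENTLY suffices at the Stage-13 datum: a SEQUENCE of bare couplings `gₙ → 0⁺` with `gₙ²·β ≤ c < 1` -/

section FrequentlyRecord

/-- ★★ **SUFFICIENT: a FREQUENT bound `g² · betaOfRecord₁₃ … 0 (g) ≤ c < 1` at `0⁺`** — along SOME sequence of bare couplings tending to `0⁺` (no eventual ∕ uniform control) ⟹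
the window at the Stage-13 datum (file 1 v1.1 `firstStep_of_frequently_sq_mul_le` + `window_datumOfRecord₁₃SepCoPH_iff_firstBeta`).  Sharp up to the constant by §1's necessary
`sq_mul_betaMerged_lt_one_of_window_datumOfRecord₁₃SepCoPH`. [cite: Balaban1987RG1, (0.17)–(0.20) pp.255–256 and §1 p.264; Balaban1989LargeFieldII, Thm 1 + (0.1) pp.355–356 (bookkeeping)] -/
theorem window_datumOfRecord₁₃SepCoPH_of_frequently_sq_mul_le (θ : Stage13HParams F N) (h : θ.Provisos₁₃SepCoPH F N) {c : ℝ} (hc : c < 1)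
    (hfr : ∃ᶠ x in 𝓝[>] (0 : ℝ), x ^ 2 * betaOfRecord₁₃ F N θ.toStage13Params 0 (fun _ => x) ≤ c) :
    ∃ γ₁ : ℝ, 0 < γ₁ ∧ ∀ γ : ℝ, 0 < γ → γ ≤ γ₁ →
      ∃ P : B12.RunParams, 1 ≤ P.K ∧ ((datumOfRecord₁₃SepCoPH F N θ h).C P).flow.InInterval γ P.K :=
  (window_datumOfRecord₁₃SepCoPH_iff_firstBeta θ h).mpr (firstStep_of_frequently_sq_mul_le _ hc hfr)

/-- ★★ **The same read at the MERGED first β-function** (`0 < θ.γ`): `∃ᶠ g in 𝓝[>] 0, g² · β_m 0 (g) ≤ c`, `c < 1` ⟹ the window — near `0⁺` the first β-function of record IS `β_m`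
(`betaOfRecord₁₃_zero_const_of_le`).  With §1's necessary form: THE WINDOW AT THE RECORD HOLDS IF `liminf_{g→0⁺} g²·β_m 0 (g) < 1` AND ONLY IF `g²·β_m 0 (g) < 1` FREQUENTLY at `0⁺`.
[cite: Balaban1987RG1, (0.17)–(0.20) pp.255–256, (1.20)–(1.22) p.264 and (2.9) p.266; Balaban1989LargeFieldII, Thm 1 + (0.1) pp.355–356 (bookkeeping)] -/
theorem window_datumOfRecord₁₃SepCoPH_of_frequently_sq_mul_betaMerged_le (θ : Stage13HParams F N) (h : θ.Provisos₁₃SepCoPH F N) (hγθ : 0 < θ.γ)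
    {c : ℝ} (hc : c < 1)
    (hfr : letI := θ.instVβ₁; letI := θ.instVβ₂; letI := θ.instιβ
      ∃ᶠ x in 𝓝[>] (0 : ℝ),
        x ^ 2 * betaMerged F (mergedTermFamilyMatT F N (TcanOfRecord F N) (chiβOfRecord₁₃ F N θ.toStage13Params) θ.εbg) θ.ρ8 θ.bV 0 (fun _ => x) ≤ c) :
    ∃ γ₁ : ℝ, 0 < γ₁ ∧ ∀ γ : ℝ, 0 < γ → γ ≤ γ₁ →
      ∃ P : B12.RunParams, 1 ≤ P.K ∧ ((datumOfRecord₁₃SepCoPH F N θ h).C P).flow.InInterval γ P.K := by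
  letI := θ.instVβ₁; letI := θ.instVβ₂; letI := θ.instιβ
  refine window_datumOfRecord₁₃SepCoPH_of_frequently_sq_mul_le θ h hc ?_
  have hlt : ∀ᶠ x in 𝓝[>] (0 : ℝ), x < θ.γ := (eventually_lt_nhds hγθ).filter_mono nhdsWithin_le_nhds
  have hpos : ∀ᶠ x in 𝓝[>] (0 : ℝ), 0 < x := eventually_mem_nhdsWithin
  refine hfr.mp ?_
  filter_upwards [hlt, hpos] with x hx hx0 hb
  rwa [betaOfRecord₁₃_zero_const_of_le θ hx0 hx.le]

end FrequentlyRecord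

end Summit.QuantumFields.YangMills.Theorems.BalabanUVNodesN13WindowAtRecord13SepCoPH

end
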